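import Summits.Ventures.Crystal3D.Theorems.StickyWulffConstantNoReconstructionGainAxisBarlowFilm
import Summits.Ventures.Crystal3D.Theorems.StickyWulffConstantNoReconstructionGainSymmetryOrbit
import HarnessLib

/-!
# Barlow films of any family at the exact `{111}` axes of the OTHER families, by lattice symmetry

HONEST FRAMING. Part of the venture `Summits/Ventures/Crystal3D` (cell `crystal3d-full`), helper
`--supports` the crux `NoReconstructionGain` (stmt-Ventures-19144, route
`route-Ventures-StickyWulffConstant`), line `adhesion`; transport of `axisBarlowFilm_adhesion`
(`…AxisBarlowFilm`: basal `B`-films at the non-basal axis `(u+v+t)/√6`) by the linear isometries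
`g` of `ℝ³` mapping `Λ₀` onto itself:

* `axisBarlowFilm_adhesion_orbit` (**the rung**, `R = 1`, `C = 0`; registered by name): for every
  lattice symmetry `g`, the unit normal `ν` with `√6 ν = g (u + v + t)`, every `ρ ≥ 1` and every finite
  unit packing `X ⊇ P` around the `ν`-slab sample whose film lies in `g B` and above the cut:
  `#cross(P, X \ P) ≤ contactDeficiency (X \ P)`.

Together with `basalBarlowFilm_adhesion_orbit` (families within `54.7°`): at an EXACT `{111}` facet
normal every single-family Barlow film of each of the four families gains nothing — the inclined Σ3
twin lamellae of multiply-twinned particles meeting a `(111)` facet included.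

WHAT THIS IS NOT: vicinal normals with inclined-family films; films mixing families; rung F-C1 not
moved.
-/

noncomputable section

namespace Summit.Ventures.Crystal3D.Theorems

open Summit.Ventures.Crystal3D Finset
open Literature.MathematicalPhysics.StatisticalMechanics (fccStacking barlowPos barlowOffset constHagg
  orderedContacts contactDeficiency)
open scoped InnerProductSpace

/-- **Barlow films of the family `g e₃` at the exact axis `g(u+v+t)/√6` of another family: the atom**
(`R = 1`, `C = 0`; registered by name on stmt-Ventures-19144). -/
theorem axisBarlowFilm_adhesion_orbit :
    ∃ R C : ℝ, 1 ≤ R ∧ ∀ ν : EuclideanSpace ℝ (Fin 3), ‖ν‖ = 1 → ∀ ρ : ℝ, R ≤ ρ →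
      ∀ X P : Finset (EuclideanSpace ℝ (Fin 3)),
      (∀ p ∈ X, ∀ q ∈ X, p ≠ q → 1 ≤ dist p q) → P ⊆ X →
      (∀ p, p ∈ P ↔ (p ∈ fccStacking 1 (Real.sqrt (2 / 3)) ∧ -(2 * R) ≤ ⟪p, ν⟫_ℝ ∧
        ⟪p, ν⟫_ℝ ≤ -R ∧ ‖p‖ ^ 2 - ⟪p, ν⟫_ℝ ^ 2 ≤ ρ ^ 2)) →
      ∀ g : EuclideanSpace ℝ (Fin 3) ≃ₗᵢ[ℝ] EuclideanSpace ℝ (Fin 3),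
      (∀ p ∈ fccStacking 1 (Real.sqrt (2 / 3)), g p ∈ fccStacking 1 (Real.sqrt (2 / 3))) →
      (∀ p ∈ fccStacking 1 (Real.sqrt (2 / 3)), g.symm p ∈ fccStacking 1 (Real.sqrt (2 / 3))) →
      Real.sqrt 6 • ν = g (barlowPos 1 (Real.sqrt (2 / 3)) constHagg 1 1 1) →
      (∀ q ∈ X \ P, q ∈ fccStacking 1 (Real.sqrt (2 / 3)) ∨
        q - g (barlowOffset 1) ∈ fccStacking 1 (Real.sqrt (2 / 3)) ∨
        q + g (barlowOffset 1) ∈ fccStacking 1 (Real.sqrt (2 / 3))) →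
      (∀ q ∈ X \ P, -R < ⟪q, ν⟫_ℝ) →
      ((((P ×ˢ (X \ P)).filter fun pq => dist pq.1 pq.2 = 1).card : ℕ) : ℝ) ≤
        contactDeficiency (X \ P) + C * ρ := by
  classical
  obtain ⟨R, C, hR, h⟩ := axisBarlowFilm_adhesion
  refine ⟨R, C, hR, fun ν hν ρ hρ X P hX hPX hP g hg hg' hax hfilm habove => ?_⟩
  -- pull back by `g⁻¹`
  have hgi : Isometry (g.symm : EuclideanSpace ℝ (Fin 3) → EuclideanSpace ℝ (Fin 3)) :=
    g.symm.isometry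
  have hinj : Function.Injective (g.symm : EuclideanSpace ℝ (Fin 3) → EuclideanSpace ℝ (Fin 3)) :=
    g.symm.injective
  set X' := X.image g.symm with hX'
  set P' := P.image g.symm with hP'def
  set ν' := g.symm ν with hν'
  have hsd : X' \ P' = (X \ P).image g.symm := by
    rw [hX', hP'def, image_sdiff_of_injOn hinj.injOn hPX]
  have hXp : ∀ p ∈ X', ∀ q ∈ X', p ≠ q → 1 ≤ dist p q := by
    intro p hp q hq hpq
    obtain ⟨p₀, hp₀, rfl⟩ := mem_image.1 hp
    obtain ⟨q₀, hq₀, rfl⟩ := mem_image.1 hq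
    rw [hgi.dist_eq]
    exact hX p₀ hp₀ q₀ hq₀ fun e => hpq (by rw [e])
  have hPXp : P' ⊆ X' := image_subset_image hPX
  have hinn : ∀ p, ⟪g.symm p, ν'⟫_ℝ = ⟪p, ν⟫_ℝ := fun p => by
    rw [hν', LinearIsometryEquiv.inner_map_map]
  have hνn : ‖ν'‖ = 1 := by rw [hν', LinearIsometryEquiv.norm_map, hν]
  have hPp : ∀ p, p ∈ P' ↔ (p ∈ fccStacking 1 (Real.sqrt (2 / 3)) ∧ -(2 * R) ≤ ⟪p, ν'⟫_ℝ ∧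
      ⟪p, ν'⟫_ℝ ≤ -R ∧ ‖p‖ ^ 2 - ⟪p, ν'⟫_ℝ ^ 2 ≤ ρ ^ 2) := by
    intro p
    rw [hP'def, mem_image]
    constructor
    · rintro ⟨p₀, hp₀, rfl⟩
      obtain ⟨hΛ, h1, h2, h3⟩ := (hP p₀).1 hp₀
      refine ⟨hg' p₀ hΛ, ?_, ?_, ?_⟩
      · rw [hinn]; exact h1
      · rw [hinn]; exact h2
      · rw [hinn, LinearIsometryEquiv.norm_map]; exact h3
    · rintro ⟨hΛ, h1, h2, h3⟩
      have hi : ⟪g p, ν⟫_ℝ = ⟪p, ν'⟫_ℝ := by rw [← hinn (g p), LinearIsometryEquiv.symm_apply_apply]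
      refine ⟨g p, (hP (g p)).2 ⟨hg p hΛ, ?_, ?_, ?_⟩, g.symm_apply_apply p⟩
      · rw [hi]; exact h1
      · rw [hi]; exact h2
      · rw [hi, LinearIsometryEquiv.norm_map]; exact h3
  -- the transported side conditions
  have hax' : Real.sqrt 6 • ν' = barlowPos 1 (Real.sqrt (2 / 3)) constHagg 1 1 1 := by
    rw [hν', ← map_smul, hax, LinearIsometryEquiv.symm_apply_apply]
  have hfilm' : ∀ q ∈ X' \ P', q ∈ fccStacking 1 (Real.sqrt (2 / 3)) ∨
      q - barlowOffset 1 ∈ fccStacking 1 (Real.sqrt (2 / 3)) ∨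
      q + barlowOffset 1 ∈ fccStacking 1 (Real.sqrt (2 / 3)) := by
    intro q hq
    rw [hsd] at hq
    obtain ⟨q₀, hq₀, rfl⟩ := mem_image.1 hq
    rcases hfilm q₀ hq₀ with h0 | h1 | h2
    · exact Or.inl (hg' q₀ h0)
    · refine Or.inr (Or.inl ?_)
      have : g.symm q₀ - barlowOffset 1 = g.symm (q₀ - g (barlowOffset 1)) := by
        rw [map_sub, LinearIsometryEquiv.symm_apply_apply]
      rw [this]; exact hg' _ h1
    · refine Or.inr (Or.inr ?_)
      have : g.symm q₀ + barlowOffset 1 = g.symm (q₀ + g (barlowOffset 1)) := by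
        rw [map_add, LinearIsometryEquiv.symm_apply_apply]
      rw [this]; exact hg' _ h2
  have habove' : ∀ q ∈ X' \ P', -R < ⟪q, ν'⟫_ℝ := by
    intro q hq
    rw [hsd] at hq
    obtain ⟨q₀, hq₀, rfl⟩ := mem_image.1 hq
    rw [hinn]; exact habove q₀ hq₀
  have hmain := h ν' hνn ρ hρ X' P' hXp hPXp hPp hax' hfilm' habove'
  rw [hsd, hP'def, card_cross_image_of_isometry hgi, contactDeficiency_image_of_isometry hgi]
    at hmain
  exact hmain

end Summit.Ventures.Crystal3D.Theorems

end
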